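import Literature.Analysis.FluidPDE.KochTataruKernelFourier
import Literature.Analysis.FluidPDE.KochTataruPairing
import Literature.Analysis.UnboundedOperators.HeatKernelFourier
import Literature.Analysis.UnboundedOperators.HeatKernelSmooth
import Mathlib.Analysis.Fourier.Inversion
import Mathlib.Analysis.Fourier.Convolution
import HarnessLib

/-!
# The semigroup law of the Oseen–Koch–Tataru kernel: `e^{tΔ} K(σ) = K(σ + t)`

Analysis/FluidPDE proof companion of `Literature/Analysis/FluidPDE/KochTataru.lean` and of
`Literature/Analysis/FluidPDE/NSBoundedMildOseen.lean` (the Oseen-kernel architecture of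
Koch–Nadirashvili–Seregin–Šverák 2009, §§3–4, behind the restart fact `oseenMild_restart`). The
kernel `K(τ, z)[a, b] = oseenKernel τ z a b` of `e^{τΔ} Π ∇·` on rank-one tensors (Koch–Tataru
2001, §2 (8)) inherits from `e^{τΔ}` the **semigroup law**

  `e^{tΔ} (K(σ, ·)[a, b]) = K(σ + t, ·)[a, b]`,  i.e.  `∫ G_t(y) K(σ, x - y)[a, b] dy = K(σ + t, x)[a, b]`

for `σ, t > 0` (`heatExtension_oseenKernel`), which is what makes the Duhamel formula
`u(t) = e^{ν(t-s)Δ}u(s) - ∫ₛᵗ e^{ν(t-τ)Δ}Π∇·(u ⊗ u) dτ` restartable ("`u = U + B(u,u)` as an ODE in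
`t`", KNSS 2009, §4 p. 8; Lemarié-Rieusset 2016, Prop. 6.4 (6.10) and Thm. 6.1: the Oseen
tensor is `e^{τΔ}ℙ`, a semigroup in `τ`). Everything here is **proved**:

* `continuous_oseenKernel`: `z ↦ K(σ, z)[a, b]` is continuous for `σ > 0` (from the gradient
  structure `K = (∂_aG_σ) b + ∫_σ^∞ Θ_s ds`, `oseenKernel_eq_fderiv_smul_add_integral`, by dominated
  convergence under the uniform decay `‖Θ_s‖ ≤ C s^{-(d+3)/2}`);
* `integrable_norm_mul_gaussian`, `integrable_fourier_inner_oseenKernel`: the Fourier symbol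
  `2πi⟪ξ,a⟫ e^{-(2π)²τ|ξ|²} ⟪P(ξ)b, w⟫` (`fourier_inner_oseenKernel_eq_leraySymbol`) is integrable;
* `inner_heatExtension_oseenKernel`, `heatExtension_oseenKernel`: the semigroup law, proved on
  the Fourier side — `𝓕(G_t ⋆ ⟪K(σ)[a,b], w⟫) = Ĝ_t · K̂(σ) = K̂(σ + t)` by the convolution theorem
  (`Real.fourier_mul_convolution_eq`), `Ĝ_t = e^{-(2π)²t|ξ|²}` (`fourierIntegral_heatKernel_holds`)
  and `heatSymbol_add` — and transported back by Fourier inversion for continuous integrable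
  functions with integrable transform (`MeasureTheory.Integrable.fourierInv_fourier_eq`);
* `integral_heatKernel_sub_smul_oseenKernel_sub`: the translated form
  `∫ G_t(x - y') K(σ, y' - y)[a, b] dy' = K(σ + t, x - y)[a, b]` consumed by Fubini arguments.

## Mathlib / tree search

Tree: `oseenKernel`, `exists_lintegral_enorm_oseenKernel_le`, `integrable_inner_oseenKernel`,
`fourier_inner_oseenKernel_eq_leraySymbol`, `norm_leraySymbol_apply_le` (`KochTataruKernelFourier`),
`oseenKernel_eq_fderiv_smul_add_integral`, `exists_norm_oseenIntegrand_le`,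
`continuous_oseenIntegrand`, `measurable_oseenIntegrand` (`KochTataruPairing`),
`fourierIntegral_heatKernel_holds` (`HeatKernelFourier`), `heatSymbol_add`, `heatKernel_le`,
`integrable_heatKernel_holds`, `contDiff_heatExtension_holds` (`HeatKernelSmooth`),
`integrable_gaussian_of_pos`, `continuous_fderiv_heatKernel` (`HeatKernelGradient`).
`lean search 'heatExtension.*oseenKernel|oseenKernel.*(σ|s|a) \+'`: nothing (the announced
`KochTataruKernelCalculus.lean` of `KochTataruDuhamelDecay.lean`'s docstring does not exist).
Mathlib: `Real.fourier_mul_convolution_eq`, `MeasureTheory.Integrable.fourierInv_fourier_eq`,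
`VectorFourier.fourierIntegral_continuous`, `Integrable.integrable_convolution`, `integral_inner`,
`continuous_of_dominated`.

## References

* H. Koch, D. Tataru, *Well-posedness for the Navier–Stokes equations*, Adv. Math. 157 (2001)
  22–35, §2 (5)–(8) (the kernels of `ΠS(t)` and `Π∇S(t)` as Fourier multipliers times
  `e^{-t|ξ|²}`). [KochTataruAdvMath2001]
* G. Koch, N. Nadirashvili, G. Seregin, V. Šverák, *Liouville theorems for the Navier–Stokes
  equations and applications*, Acta Math. 203 (2009) 83–105 = arXiv:0709.3599, §3 p. 6 (the
  representation formula) and §4 p. 8 (`u = U + B(u,u)` "as an ODE in `t`").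
  [KochNadirashviliSereginSverak2009]
* P. G. Lemarié-Rieusset, *The Navier–Stokes problem in the 21st century*, CRC Press 2016,
  Prop. 6.4 (6.10) and Thm. 6.1 (the Oseen tensor `e^{νtΔ}ℙ`). [LemarieRieusset2016]
-/

noncomputable section

open MeasureTheory Set Function Filter Topology Metric Real
open scoped ENNReal NNReal RealInnerProductSpace FourierTransform Convolution

namespace Literature.Analysis.FluidPDE

open UnboundedOperators (heatKernel heatSymbol heatExtension)

variable {E : Type*} [NormedAddCommGroup E] [InnerProductSpace ℝ E] [FiniteDimensional ℝ E]
  [MeasurableSpace E] [BorelSpace E]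

/-! ## Continuity of the kernel in space -/

section Continuity

/-- **The Oseen–Koch–Tataru kernel is continuous in space**: for `σ > 0` and `a, b ∈ E` the map
`z ↦ K(σ, z)[a, b]` is continuous (indeed smooth; Koch–Tataru 2001, §2 (8): `K` is a combination
of derivatives of Gaussians). Proof: `K(σ, z)[a, b] = (∂_aG_σ)(z) b + ∫_σ^∞ Θ_s(z)[a, b] ds`
(`oseenKernel_eq_fderiv_smul_add_integral`) with `Θ_s` continuous in `z` and dominated by the
integrable `C s^{-(d+3)/2} ‖a‖ ‖b‖` (`exists_norm_oseenIntegrand_le`). [cite: KochTataruAdvMath2001, §2 (8)] -/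
theorem continuous_oseenKernel {σ : ℝ} (hσ : 0 < σ) (a b : E) :
    Continuous fun z : E => oseenKernel σ z a b := by
  obtain ⟨C, -, hΘ⟩ := exists_norm_oseenIntegrand_le (E := E)
  have hrepr : (fun z : E => oseenKernel σ z a b) = fun z =>
      (fderiv ℝ (heatKernel σ) z a) • b + ∫ s in Ioi σ, oseenIntegrand s z a b := by
    funext z
    exact oseenKernel_eq_fderiv_smul_add_integral hσ z a b
  rw [hrepr]
  refine Continuous.add ?_ ?_
  · exact ((UnboundedOperators.continuous_fderiv_heatKernel σ).clm_apply continuous_const).smul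
      continuous_const
  · set r : ℝ := -(((Module.finrank ℝ E : ℝ) + 3) / 2) with hr
    have hr1 : r < -1 := by
      have : (0 : ℝ) ≤ Module.finrank ℝ E := Nat.cast_nonneg _
      rw [hr]; linarith
    refine continuous_of_dominated (μ := (volume : Measure ℝ).restrict (Ioi σ))
      (bound := fun s => C * s ^ r * ‖a‖ * ‖b‖) ?_ ?_ ?_ ?_
    · intro z
      exact ((measurable_oseenIntegrand a b).comp
        (measurable_id.prodMk measurable_const)).aestronglyMeasurable
    · intro z
      exact (ae_restrict_iff' measurableSet_Ioi).2 (Eventually.of_forall fun s hs =>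
        hΘ (hσ.trans hs) z a b)
    · exact (((integrableOn_Ioi_rpow_of_lt hr1 hσ).const_mul C).mul_const ‖a‖).mul_const ‖b‖
    · exact Eventually.of_forall fun s => continuous_oseenIntegrand s a b

/-- Continuity of the scalar entries `z ↦ ⟪K(σ, z)[a, b], w⟫` (`σ > 0`). [cite: KochTataruAdvMath2001, §2 (8)] -/
theorem continuous_inner_oseenKernel {σ : ℝ} (hσ : 0 < σ) (a b w : E) :
    Continuous fun z : E => ⟪oseenKernel σ z a b, w⟫ :=
  (continuous_oseenKernel hσ a b).inner continuous_const

end Continuity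

/-! ## Integrability of the Fourier symbol -/

section Symbol

/-- `ξ ↦ ‖ξ‖ e^{-b‖ξ‖²}` is integrable on a finite-dimensional inner product space (`b > 0`):
`‖ξ‖ ≤ 1 + ‖ξ‖²` and `‖ξ‖² e^{-b‖ξ‖²} ≤ (2/b) e^{-(b/2)‖ξ‖²}`. [folklore] -/
theorem integrable_norm_mul_gaussian {b : ℝ} (hb : 0 < b) :
    Integrable (fun ξ : E => ‖ξ‖ * Real.exp (-b * ‖ξ‖ ^ 2)) := by
  have hb2 : 0 < b / 2 := by positivity
  have hdom : ∀ ξ : E, ‖ξ‖ * Real.exp (-b * ‖ξ‖ ^ 2) ≤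
      Real.exp (-b * ‖ξ‖ ^ 2) + 2 / b * Real.exp (-(b / 2) * ‖ξ‖ ^ 2) := by
    intro ξ
    have h1 : ‖ξ‖ ≤ 1 + ‖ξ‖ ^ 2 := by nlinarith [norm_nonneg ξ, sq_nonneg (‖ξ‖ - 1 / 2)]
    have h2 : ‖ξ‖ ^ 2 * Real.exp (-b * ‖ξ‖ ^ 2) ≤ 2 / b * Real.exp (-(b / 2) * ‖ξ‖ ^ 2) := by
      have hy : b / 2 * ‖ξ‖ ^ 2 + 1 ≤ Real.exp (b / 2 * ‖ξ‖ ^ 2) := Real.add_one_le_exp _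
      have hsq : ‖ξ‖ ^ 2 ≤ 2 / b * Real.exp (b / 2 * ‖ξ‖ ^ 2) := by
        rw [div_mul_eq_mul_div, le_div_iff₀ hb]
        nlinarith
      have hexp : Real.exp (-b * ‖ξ‖ ^ 2) =
          Real.exp (-(b / 2) * ‖ξ‖ ^ 2) * (Real.exp (b / 2 * ‖ξ‖ ^ 2))⁻¹ := by
        rw [← Real.exp_neg, ← Real.exp_add]
        congr 1; ring
      have hpos : 0 < Real.exp (b / 2 * ‖ξ‖ ^ 2) := Real.exp_pos _
      rw [hexp, ← mul_assoc, mul_inv_le_iff₀ hpos]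
      calc ‖ξ‖ ^ 2 * Real.exp (-(b / 2) * ‖ξ‖ ^ 2)
          ≤ (2 / b * Real.exp (b / 2 * ‖ξ‖ ^ 2)) * Real.exp (-(b / 2) * ‖ξ‖ ^ 2) := by gcongr
        _ = 2 / b * Real.exp (-(b / 2) * ‖ξ‖ ^ 2) * Real.exp (b / 2 * ‖ξ‖ ^ 2) := by ring
    calc ‖ξ‖ * Real.exp (-b * ‖ξ‖ ^ 2) ≤ (1 + ‖ξ‖ ^ 2) * Real.exp (-b * ‖ξ‖ ^ 2) := by gcongr
      _ = Real.exp (-b * ‖ξ‖ ^ 2) + ‖ξ‖ ^ 2 * Real.exp (-b * ‖ξ‖ ^ 2) := by ring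
      _ ≤ Real.exp (-b * ‖ξ‖ ^ 2) + 2 / b * Real.exp (-(b / 2) * ‖ξ‖ ^ 2) := by gcongr
  refine Integrable.mono' ((UnboundedOperators.integrable_gaussian_of_pos hb).add
    ((UnboundedOperators.integrable_gaussian_of_pos hb2).const_mul (2 / b)))
    (by fun_prop : Continuous fun ξ : E => ‖ξ‖ * Real.exp (-b * ‖ξ‖ ^ 2)).aestronglyMeasurable
    (Eventually.of_forall fun ξ => ?_)
  rw [Real.norm_of_nonneg (by positivity)]
  exact hdom ξ

/-- **The Fourier symbol of the kernel entries is integrable**: for `τ > 0`,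
`ξ ↦ 𝓕 (⟪K(τ, ·)[a, b], w⟫)(ξ) = 2πi⟪ξ, a⟫ e^{-(2π)²τ‖ξ‖²} ⟪P(ξ)b, w⟫` is in `L¹` (bounded by
`2π ‖a‖ ‖b‖ ‖w‖ · ‖ξ‖ e^{-(2π)²τ‖ξ‖²}`, `‖P(ξ)‖ ≤ 1`; Koch–Tataru 2001, §2 (6)–(8)). [cite: KochTataruAdvMath2001, §2 (6)–(8)] -/
theorem integrable_fourier_inner_oseenKernel {τ : ℝ} (hτ : 0 < τ) (a b w : E) :
    Integrable (𝓕 (fun z : E => ((⟪oseenKernel τ z a b, w⟫ : ℝ) : ℂ))) := by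
  have hg := integrable_inner_oseenKernel hτ a b w
  have hcont : Continuous (𝓕 (fun z : E => ((⟪oseenKernel τ z a b, w⟫ : ℝ) : ℂ))) :=
    VectorFourier.fourierIntegral_continuous Real.continuous_fourierChar continuous_inner hg
  set β : ℝ := (2 * π) ^ 2 * τ with hβ
  have hβ0 : 0 < β := by positivity
  refine Integrable.mono' ((integrable_norm_mul_gaussian hβ0).const_mul (2 * π * ‖a‖ * ‖b‖ * ‖w‖))
    hcont.aestronglyMeasurable (Eventually.of_forall fun ξ => ?_)
  rw [fourier_inner_oseenKernel_eq_leraySymbol hτ a b w ξ]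
  have hS : heatSymbol τ ξ = Real.exp (-β * ‖ξ‖ ^ 2) := by
    rw [hβ, UnboundedOperators.heatSymbol]; ring_nf
  have h1 : |⟪ξ, a⟫| ≤ ‖ξ‖ * ‖a‖ := abs_real_inner_le_norm ξ a
  have h2 : |⟪leraySymbol ξ b, w⟫| ≤ ‖b‖ * ‖w‖ :=
    (abs_real_inner_le_norm _ _).trans
      (mul_le_mul_of_nonneg_right (norm_leraySymbol_apply_le ξ b) (norm_nonneg _))
  simp only [norm_mul, Complex.norm_real, Complex.norm_I, Real.norm_eq_abs, Complex.norm_ofNat,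
    mul_one]
  rw [abs_of_pos Real.pi_pos, abs_of_pos (UnboundedOperators.heatSymbol_pos τ ξ), hS]
  calc 2 * π * |⟪ξ, a⟫| * Real.exp (-β * ‖ξ‖ ^ 2) * |⟪leraySymbol ξ b, w⟫|
      ≤ 2 * π * (‖ξ‖ * ‖a‖) * Real.exp (-β * ‖ξ‖ ^ 2) * (‖b‖ * ‖w‖) := by gcongr
    _ = 2 * π * ‖a‖ * ‖b‖ * ‖w‖ * (‖ξ‖ * Real.exp (-β * ‖ξ‖ ^ 2)) := by ring

end Symbol

/-! ## The semigroup law -/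

section Semigroup

/-- The vector convolution integrand `y ↦ G_t(y) • K(σ, x - y)[a, b]` of `e^{tΔ}K(σ)[a, b](x)` is
integrable (`t, σ > 0`): a bounded Gaussian times a translate of the integrable kernel
(Koch–Tataru 2001, (14)). [cite: KochTataruAdvMath2001, §3 (14)] -/
theorem integrable_heatKernel_smul_oseenKernel_sub {σ t : ℝ} (hσ : 0 < σ) (ht : 0 < t)
    (a b x : E) :
    Integrable (fun y : E => heatKernel t y • oseenKernel σ (x - y) a b) := by
  obtain ⟨C, -, hK⟩ := exists_lintegral_enorm_oseenKernel_le (E := E)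
  have h1 : Integrable (fun y : E => oseenKernel σ (x - y) a b) := (hK hσ a b).1.comp_sub_left x
  refine (h1.norm.const_mul ((4 * π * t) ^ (-(Module.finrank ℝ E : ℝ) / 2))).mono'
    ((UnboundedOperators.continuous_heatKernel t).aestronglyMeasurable.smul h1.1)
    (Eventually.of_forall fun y => ?_)
  rw [norm_smul, Real.norm_of_nonneg (UnboundedOperators.heatKernel_pos ht y).le]
  exact mul_le_mul_of_nonneg_right (UnboundedOperators.heatKernel_le ht y) (norm_nonneg _)

/-- **The semigroup law of the Oseen–Koch–Tataru kernel, tested form**: for `σ, t > 0` and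
`a, b, w, x ∈ E`, `⟪(e^{tΔ} K(σ, ·)[a, b])(x), w⟫ = ⟪K(σ + t, x)[a, b], w⟫`, where
`e^{tΔ} = heatExtension · t` is convolution with the Gauss–Weierstrass kernel. On the Fourier
side this is `Ĝ_t(ξ) · 2πi⟪ξ,a⟫Ĝ_σ(ξ)P(ξ)b = 2πi⟪ξ,a⟫Ĝ_{σ+t}(ξ)P(ξ)b` (Koch–Tataru 2001, §2
(6)–(8): the kernel of `Π∇S(t)` is the multiplier `iξ m(ξ)` times `e^{-t|ξ|²}`), and both sides
are continuous integrable functions with integrable Fourier transform, so Fourier inversion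
applies pointwise. [cite: KochTataruAdvMath2001, §2 (6)–(8)] -/
theorem inner_heatExtension_oseenKernel {σ t : ℝ} (hσ : 0 < σ) (ht : 0 < t) (a b w x : E) :
    ⟪heatExtension (fun z => oseenKernel σ z a b) t x, w⟫ = ⟪oseenKernel (σ + t) x a b, w⟫ := by
  haveI : CompleteSpace E := FiniteDimensional.complete ℝ E
  have hσt : 0 < σ + t := add_pos hσ ht
  -- the scalar entries and the Gaussian, as complex-valued functions
  set g : ℝ → E → ℂ := fun τ z => ((⟪oseenKernel τ z a b, w⟫ : ℝ) : ℂ) with hg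
  set G : E → ℂ := fun y => ((heatKernel t y : ℝ) : ℂ) with hG
  have hg_int : ∀ {τ : ℝ}, 0 < τ → Integrable (g τ) := fun hτ =>
    integrable_inner_oseenKernel hτ a b w
  have hG_int : Integrable G := (UnboundedOperators.integrable_heatKernel_holds ht).ofReal
  obtain ⟨C, -, hK⟩ := exists_lintegral_enorm_oseenKernel_le (E := E)
  have hKint : Integrable (fun z : E => oseenKernel σ z a b) := (hK hσ a b).1
  -- the complex convolution `G ⋆ g σ` is the tested heat extension
  have hconv : (G ⋆[ContinuousLinearMap.mul ℂ ℂ, volume] g σ) = fun x =>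
      ((⟪heatExtension (fun z => oseenKernel σ z a b) t x, w⟫ : ℝ) : ℂ) := by
    funext x'
    rw [convolution_def, UnboundedOperators.heatExtension_apply,
      real_inner_comm w, ← integral_inner (integrable_heatKernel_smul_oseenKernel_sub hσ ht a b x') w,
      ← integral_complex_ofReal]
    refine integral_congr_ae (Eventually.of_forall fun y => ?_)
    simp only [hG, hg, ContinuousLinearMap.mul_apply', real_inner_smul_right, real_inner_comm w,
      Complex.ofReal_mul]
  -- the Fourier transforms of `G ⋆ g σ` and `g (σ + t)` coincide
  have hF : 𝓕 (G ⋆[ContinuousLinearMap.mul ℂ ℂ, volume] g σ) = 𝓕 (g (σ + t)) := by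
    funext ξ
    rw [Real.fourier_mul_convolution_eq hG_int (hg_int hσ) ξ]
    simp only [hG, hg]
    rw [UnboundedOperators.fourierIntegral_heatKernel_holds ht ξ,
      fourier_inner_oseenKernel_eq_leraySymbol hσ, fourier_inner_oseenKernel_eq_leraySymbol hσt,
      congrFun (UnboundedOperators.heatSymbol_add (E := E) σ t) ξ]
    simp only [Pi.mul_apply]
    push_cast
    ring
  have hsymb : Integrable (𝓕 (g (σ + t))) := integrable_fourier_inner_oseenKernel hσt a b w
  -- both functions are continuous
  have hcont_conv : Continuous (G ⋆[ContinuousLinearMap.mul ℂ ℂ, volume] g σ) := by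
    rw [hconv]
    have hsm : ContDiff ℝ ((⊤ : ℕ∞) : WithTop ℕ∞) (heatExtension (fun z => oseenKernel σ z a b) t) :=
      UnboundedOperators.contDiff_heatExtension_holds (memLp_one_iff_integrable.2 hKint) le_rfl ht
    exact Complex.continuous_ofReal.comp (hsm.continuous.inner continuous_const)
  have hcont_g : Continuous (g (σ + t)) :=
    Complex.continuous_ofReal.comp (continuous_inner_oseenKernel hσt a b w)
  -- Fourier inversion on both sides
  have hconv_int : Integrable (G ⋆[ContinuousLinearMap.mul ℂ ℂ, volume] g σ) :=
    hG_int.integrable_convolution _ (hg_int hσ)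
  have hsymb' : Integrable (𝓕 (G ⋆[ContinuousLinearMap.mul ℂ ℂ, volume] g σ)) := by
    rw [hF]; exact hsymb
  have h1 : (G ⋆[ContinuousLinearMap.mul ℂ ℂ, volume] g σ) x = 𝓕⁻ (𝓕 (g (σ + t))) x := by
    rw [← hF]
    exact (hconv_int.fourierInv_fourier_eq hsymb' hcont_conv.continuousAt).symm
  have h2 : 𝓕⁻ (𝓕 (g (σ + t))) x = g (σ + t) x :=
    (hg_int hσt).fourierInv_fourier_eq hsymb hcont_g.continuousAt
  have h3 := h1.trans h2
  rw [hconv] at h3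
  simp only [hg] at h3
  exact_mod_cast h3

/-- **The semigroup law of the Oseen–Koch–Tataru kernel** (`e^{tΔ}` acts on the kernel of
`e^{σΔ}Π∇·` by shifting the time: Koch–Tataru 2001, §2 (6)–(8); KNSS 2009, §4 p. 8, the
integral equation `u = U + B(u,u)` "as an ODE in `t`"): for `σ, t > 0` and `a, b, x ∈ E`,
`(e^{tΔ} K(σ, ·)[a, b])(x) = ∫ G_t(y) K(σ, x - y)[a, b] dy = K(σ + t, x)[a, b]`. [cite: KochTataruAdvMath2001, §2 (6)–(8)] -/
theorem heatExtension_oseenKernel {σ t : ℝ} (hσ : 0 < σ) (ht : 0 < t) (a b x : E) :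
    heatExtension (fun z => oseenKernel σ z a b) t x = oseenKernel (σ + t) x a b :=
  ext_inner_right ℝ fun w => inner_heatExtension_oseenKernel hσ ht a b w x

/-- The semigroup law as an explicit integral: `∫ G_t(y) • K(σ, x - y)[a, b] dy = K(σ + t, x)[a, b]`
(`σ, t > 0`). [cite: KochTataruAdvMath2001, §2 (6)–(8)] -/
theorem integral_heatKernel_smul_oseenKernel_sub {σ t : ℝ} (hσ : 0 < σ) (ht : 0 < t)
    (a b x : E) :
    ∫ y, heatKernel t y • oseenKernel σ (x - y) a b = oseenKernel (σ + t) x a b := by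
  have h := heatExtension_oseenKernel hσ ht a b x
  rwa [UnboundedOperators.heatExtension_apply] at h

/-- **The semigroup law in translated form** (the shape consumed by Fubini arguments for the
Duhamel term): `∫ G_t(x - y') • K(σ, y' - y)[a, b] dy' = K(σ + t, x - y)[a, b]` for `σ, t > 0`
(substitute `y' = x - z`). [cite: KochTataruAdvMath2001, §2 (6)–(8)] -/
theorem integral_heatKernel_sub_smul_oseenKernel_sub {σ t : ℝ} (hσ : 0 < σ) (ht : 0 < t)
    (a b x y : E) :
    ∫ y', heatKernel t (x - y') • oseenKernel σ (y' - y) a b = oseenKernel (σ + t) (x - y) a b := by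
  rw [← integral_heatKernel_smul_oseenKernel_sub hσ ht a b (x - y),
    ← integral_sub_left_eq_self (fun z => heatKernel t z • oseenKernel σ (x - y - z) a b) volume x]
  refine integral_congr_ae (Eventually.of_forall fun z => ?_)
  dsimp only
  rw [sub_sub_sub_cancel_left]

end Semigroup

end Literature.Analysis.FluidPDE
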